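import Literature.NumberTheory.Automorphic.BoundaryShapiro
import Literature.NumberTheory.Automorphic.BoundaryRestrictionHecke
import Literature.Algebra.Homology.ShapiroNaturality
import HarnessLib

/-!
# The cohomology of the boundary is the cohomology of the parabolic, as a Hecke module

Topic `NumberTheory/Automorphic`; namespace `Literature.NumberTheory.Automorphic.TwistedQuotient`.  A
*proofs* file (theorems only; no definition, no named fact, no instance) completing
`BoundaryShapiro`: there the isomorphism
`toStratumCohomology : H^q(Γ, Fun(N(P)₀ × 𝒢/L, V)) ≅ H^q(Γ_{x₀}, Fun(𝒢/L, V))` (restriction to the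
orbit of a vertex `x₀` with stabiliser `Γ_{x₀}`, then Mathlib's Shapiro isomorphism `coindIso`) was
shown to be Hecke-equivariant only in its first factor; with the naturality of `coindIso` in the
coefficient representation (`Literature.Algebra.Homology.coindIso_hom_naturality`, `ShapiroNaturality`)
it is Hecke-equivariant outright (`toStratumCohomology_comp_heckeOperator`): the double-coset
operator `[L g L]` on the boundary cohomology corresponds to the double-coset operator of the SAME
`g` on `cohomology (ι.comp Γ_{x₀}.subtype) L (ρ.comp Γ_{x₀}.subtype) q = H^q(Γ_{x₀}, Fun(𝒢/L, V))`,
the cohomology of the stratum.  Combined with `BoundaryRestrictionHecke` (for an antichain `P`, a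
class is interior iff its restriction to `H^q(Γ, Fun(N(P)₀ × 𝒢/L, V))` vanishes) this gives, for a
discrete building with a single `Γ`-orbit of vertices (e.g. `GL₂`: `P = ℙ¹(F)`, `Γ_{x₀} = B(F)`):
**a non-interior simultaneous Hecke eigenclass of `H^q(S_L, Ṽ)` yields a non-zero simultaneous
eigenclass of `H^q(Γ_{x₀}, Fun(𝒢/L, V))` with the same eigenvalues**
(`exists_stratum_eigenclass_of_not_isInterior`) — the reduction of
`Literature.NumberTheory.Automorphic.bianchi_boundaryEigensystem_isReducible` to the cohomology of
the Borel subgroup [Harder1987, §1 and §2], [Schwermer2010, §6 (6.2)].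

## Main results

* `toStratumCohomology_comp_heckeOperator`, `toStratumCohomology_heckeEnd_apply` — Hecke-equivariance.
* `toStratumCohomology_injective` — for a transitive action on `P`.
* `exists_stratum_eigenclass_of_not_isInterior` — the reduction statement, for a family of Hecke
  operators indexed by any type and eigenvalue equations holding eventually along any filter.

## References

* G. Harder, *Eisenstein cohomology of arithmetic groups. The case GL₂*, Invent. Math. 89 (1987), §1,
  §2 [Harder1987].
* J. Schwermer, Bull. AMS 47 (2010), §6 (6.1)–(6.2) [Schwermer2010].
* K. S. Brown, *Cohomology of groups*, GTM 87 (1982), III §6 (6.2) [Brown1982CohomologyGroups].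
-/

noncomputable section

open CategoryTheory
open scoped Classical

universe u

namespace Literature.NumberTheory.Automorphic

namespace TwistedQuotient

variable {k : Type u} [CommRing k] {Γ 𝒢 : Type u} [Group Γ] [Group 𝒢]
variable (ι : Γ →* 𝒢) (L : Subgroup 𝒢) {V : Type u} [AddCommGroup V] [Module k V]
  (ρ : Representation k Γ V) (P : Type u) [Preorder P] [MulAction Γ P]
  (hP : ∀ γ : Γ, Monotone fun x : P => γ • x) (x₀ : P)

omit [Preorder P] in
/-- **Shapiro's isomorphism for the stratum is Hecke-equivariant** (the second factor of
`toStratumCohomology`): `H^q(Coind T_g) ≫ coindIso = coindIso ≫ T_g`, an instance of the naturality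
of Mathlib's `coindIso` in the representation. [cite: Brown1982CohomologyGroups, III §6 (6.2)] -/
theorem coindHeckeOperator_comp_coindIso_hom (g : 𝒢) (q : ℕ) :
    coindHeckeOperator ι L ρ P x₀ g q ≫
        (groupCohomology.coindIso (stratumRep ι L ρ x₀) q).hom =
      (groupCohomology.coindIso (stratumRep ι L ρ x₀) q).hom ≫
        heckeOperator (ι.comp (vertexStabilizer (Γ := Γ) x₀).subtype) L
          (ρ.comp (vertexStabilizer (Γ := Γ) x₀).subtype) g q :=
  Literature.Algebra.Homology.coindIso_hom_naturality _ q

/-- **`H^q(∂) → H^q(Γ_{x₀}, Fun(𝒢/L, V))` is Hecke-equivariant**: `toStratumCohomology` intertwines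
the double-coset operator `[L g L]` on the cohomology of column `0` of the boundary
(`bdryHeckeOperator`) with the double-coset operator of the same `g` on the cohomology of the
stratum (`heckeOperator` for the subgroup `Γ_{x₀}`, `ι` and `ρ` restricted).
[cite: Harder1987, §1] [cite: Schwermer2010, §6 (6.2)] -/
theorem toStratumCohomology_comp_heckeOperator (g : 𝒢) (q : ℕ) :
    toStratumCohomology ι L ρ P hP x₀ q ≫
        heckeOperator (ι.comp (vertexStabilizer (Γ := Γ) x₀).subtype) L
          (ρ.comp (vertexStabilizer (Γ := Γ) x₀).subtype) g q =
      bdryHeckeOperator ι L ρ P hP g q ≫ toStratumCohomology ι L ρ P hP x₀ q := by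
  rw [toStratumCohomology, Category.assoc, ← coindHeckeOperator_comp_coindIso_hom,
    ← Category.assoc, bdryOrbitRestrictMap_comp_coindHeckeOperator, Category.assoc]

/-- Element form: `toStratum (T_g x) = T_g (toStratum x)`. [cite: Harder1987, §1] -/
theorem toStratumCohomology_heckeEnd_apply (g : 𝒢) (q : ℕ) (x : bdryCohomology ι L ρ P hP q) :
    (toStratumCohomology ι L ρ P hP x₀ q).hom (bdryHeckeEnd ι L ρ P hP g q x) =
      heckeEnd (ι.comp (vertexStabilizer (Γ := Γ) x₀).subtype) L
        (ρ.comp (vertexStabilizer (Γ := Γ) x₀).subtype) g q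
        ((toStratumCohomology ι L ρ P hP x₀ q).hom x) := by
  change (bdryHeckeOperator ι L ρ P hP g q ≫ toStratumCohomology ι L ρ P hP x₀ q).hom x =
    (toStratumCohomology ι L ρ P hP x₀ q ≫
      heckeOperator (ι.comp (vertexStabilizer (Γ := Γ) x₀).subtype) L
        (ρ.comp (vertexStabilizer (Γ := Γ) x₀).subtype) g q).hom x
  rw [toStratumCohomology_comp_heckeOperator]

/-- An eigenvector of `T_g` on the boundary maps to an eigenvector of `T_g` on the stratum, same
eigenvalue. [folklore] -/
theorem heckeEnd_toStratumCohomology_of_eigen (g : 𝒢) (q : ℕ) {x : bdryCohomology ι L ρ P hP q}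
    {a : k} (hx : bdryHeckeEnd ι L ρ P hP g q x = a • x) :
    heckeEnd (ι.comp (vertexStabilizer (Γ := Γ) x₀).subtype) L
        (ρ.comp (vertexStabilizer (Γ := Γ) x₀).subtype) g q
        ((toStratumCohomology ι L ρ P hP x₀ q).hom x) =
      a • (toStratumCohomology ι L ρ P hP x₀ q).hom x := by
  rw [← toStratumCohomology_heckeEnd_apply, hx, map_smul]

/-- For a transitive action on `P`, `toStratumCohomology` is injective (it is an isomorphism,
`isIso_toStratumCohomology`). [cite: Schwermer2010, §6 (6.2)] -/
theorem toStratumCohomology_injective (htrans : ∀ x : P, ∃ γ : Γ, γ • x₀ = x) (q : ℕ) :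
    Function.Injective (toStratumCohomology ι L ρ P hP x₀ q).hom := by
  intro a b h
  have h' : (toStratumCohomology ι L ρ P hP x₀ q ≫ ofStratumCohomology ι L ρ P hP x₀ q).hom a =
      (toStratumCohomology ι L ρ P hP x₀ q ≫ ofStratumCohomology ι L ρ P hP x₀ q).hom b := by
    change (ofStratumCohomology ι L ρ P hP x₀ q).hom ((toStratumCohomology ι L ρ P hP x₀ q).hom a) =
      (ofStratumCohomology ι L ρ P hP x₀ q).hom ((toStratumCohomology ι L ρ P hP x₀ q).hom b)
    rw [h]
  rwa [toStratumCohomology_comp_ofStratumCohomology ι L ρ P hP x₀ htrans q] at h'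

/-- **Reduction to the parabolic.**  Let `P` be an antichain (discrete Tits building) on which `Γ`
acts transitively with stabiliser `Γ_{x₀}` of the vertex `x₀` (for `GL₂`: `P = ℙ¹(F)`,
`Γ_{x₀} = B(F)`).  If `x ∈ H^q(S_L, Ṽ)` is NOT interior and is, eventually along a filter `l` on an
index type `W`, a simultaneous eigenvector of Hecke operators `T_{g j w}` (`j ∈ J`) with eigenvalues
`a w j`, then its image `y` in the cohomology `H^q(Γ_{x₀}, Fun(𝒢/L, V))` of the stratum (restriction
to the boundary, restriction to the orbit of `x₀`, Shapiro) is NON-ZERO and is, eventually along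
`l`, a simultaneous eigenvector of the operators `T_{g j w}` of the stratum with the SAME eigenvalues
— "the eigensystem occurs in the cohomology of the boundary, which is the cohomology of the Borel
stratum". [cite: Harder1987, §1] [cite: Schwermer2010, §5.3 and §6 (6.2)] -/
theorem exists_stratum_eigenclass_of_not_isInterior (hanti : ∀ x y : P, x ≤ y → x = y)
    (htrans : ∀ x : P, ∃ γ : Γ, γ • x₀ = x) (q : ℕ) {x : cohomology ι L ρ q}
    (hx : x ∉ interiorCohomology ι L ρ P hP q) {W J : Type*} (l : Filter W) (g : J → W → 𝒢)
    (a : W → J → k) (ha : ∀ᶠ w in l, ∀ j, heckeEnd ι L ρ (g j w) q x = a w j • x) :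
    ∃ y : cohomology (ι.comp (vertexStabilizer (Γ := Γ) x₀).subtype) L
        (ρ.comp (vertexStabilizer (Γ := Γ) x₀).subtype) q,
      y ≠ 0 ∧ ∀ᶠ w in l, ∀ j,
        heckeEnd (ι.comp (vertexStabilizer (Γ := Γ) x₀).subtype) L
          (ρ.comp (vertexStabilizer (Γ := Γ) x₀).subtype) (g j w) q y = a w j • y := by
  refine ⟨(toStratumCohomology ι L ρ P hP x₀ q).hom ((bdryRestrict ι L ρ P hP q).hom x), ?_, ?_⟩
  · intro h0
    apply bdryRestrict_ne_zero_of_not_mem_interiorCohomology ι L ρ P hP hanti q hx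
    apply toStratumCohomology_injective ι L ρ P hP x₀ htrans q
    rw [h0, map_zero]
  · exact ha.mono fun w hw j =>
      heckeEnd_toStratumCohomology_of_eigen ι L ρ P hP x₀ (g j w) q
        (bdryHeckeEnd_bdryRestrict_of_eigen ι L ρ P hP (g j w) q (hw j))

end TwistedQuotient

end Literature.NumberTheory.Automorphic
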